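import Summits.CriticalPhenomena.PercolationContinuityZ3.Theorems.Transplant.GrigorchukCayleyLabelRigidity
import Summits.CriticalPhenomena.PercolationContinuityZ3.Theorems.Transplant.GrigorchukLamplighterLabelRigidity
import HarnessLib

/-!
# The Cayley graph `Cay(𝔊 × ℤ; a, b, c, d, z)` of the first Grigorchuk group times `ℤ`: letters, separation, and the adjacency-defined edge classes
# (`IsA` = `a`, `IsT` = `{b, c, d}`, `IsS` = `z^{±1}`) — label rigidity for the second witness of record, part I

builds on p205010 (kernel theorem, internal audit signed; external expert review pending) — nothing in this file uses p205010; graph theory of ONE Cayley graph,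
no percolation statement, nothing about any `@[conjecture]` (MUST-NOTs stand; `θ(p_c)` on this graph is NOT proved in tree or print).  Lane `prim-bschramm`,
seat `prim-bschramm-p3` gen 39 (DESIGN OWNER; `P3-NILPOTENT.md` §32.3, item O19b; GO lead g26 #8453, refuter-first).  Helper file
(`--supports stmt-CriticalPhenomena-4575 --as helper`).  No new model of `𝔊`, no instance, no notation; the six letter codes `L6` (`a b c d s si`, the code `s`
naming here the central letter `z`), their tree words / lamp sums and the Boolean separation test `sepB` are «GrigorchukLamplighterShortCycles»' (p606146), the
generic predicates `TriE / SqT / IsT / IsA / IsS` «GrigorchukLamplighterCayleyClasses»' (p606355) — IMPORTED, not restated.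

WHY.  After O19 (p640733 / p641086: `Aut(Cay(𝔊; a,b,c,d)) = 𝔊`) the planners' SECOND open witness for the residue node is `𝔊 × ℤ` (vb₁ = 1; VERDICTS :439 (b3):
«a rank-ONE character gives no planar skeleton — no node of the lane applies; not in print»).  This file and its sequels («GrigorchukTimesZLabelRigidity»,
«GrigorchukTimesZAutGroup») make that sentence an Aut-level kernel statement: `Aut(Cay(𝔊 × ℤ; a,b,c,d,z)) = (𝔊 × ℤ) ⋊ C₂` (left translations and the flip
`(g, n) ↦ (g, −n)`), every character of every group of automorphisms has RANK ≤ 1, hence no orbit datum / quasi-step datum / planar skeleton / rank-two input.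
THIS FILE (the census, part I — the B–E census of p606355 with `s ↦ z`): §1 the group `GZ = 𝔊 × ℤ`, the letters `aP … dP, zP`, the graph `gzCay`, adjacency
= right multiplication by the six codes; §2 separation (`prodP_ne_of_sep`: lamp sum ↦ the `ℤ`-coordinate, tree word ↦ the `𝔊`-coordinate, finite model p599763);
§3 `TriE (u, u·y) ⇔ y ∈ {b,c,d}` (no product of two letters is `a` or `z`), `SqT` at `z^{±1}` (`z` central), not at `a` (`a t y ≠ t′`), the classes.
[cite: Grigorchuk1980, relations of 𝔊] [cite: BenjaminiSchramm1996, §2 (Cayley graphs); Conj. 4] [cite: BartholdiErschler2012, §3.1 (wreath recursion — the finite model)]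
-/

noncomputable section

namespace Summit.CriticalPhenomena.PercolationContinuityZ3.Theorems.Transplant

namespace Grigorchuk

open SimpleGraph
open scoped Classical

/-! ### §1 The group `𝔊 × ℤ`, the letters, the graph, adjacency -/

/-- The group `𝔊 × ℤ` (the `ℤ` factor written multiplicatively). [cite: BenjaminiSchramm1996, §2 (Cayley graphs)] -/
abbrev GZ : Type := ↥grigorchukGroup × Multiplicative ℤ

/-- The letter `a = (a, 0)` of `𝔊 × ℤ`. [cite: Grigorchuk1980, definition of a] -/
def aP : GZ := (aG, 1)
/-- The letter `b = (b, 0)`. [cite: Grigorchuk1980, definition of b] -/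
def bP : GZ := (bG, 1)
/-- The letter `c = (c, 0)`. [cite: Grigorchuk1980, definition of c] -/
def cP : GZ := (cG, 1)
/-- The letter `d = (d, 0)`. [cite: Grigorchuk1980, definition of d] -/
def dP : GZ := (dG, 1)
/-- The central letter `z = (1, 1)`, generator of the `ℤ` factor. [folklore] -/
def zP : GZ := (1, Multiplicative.ofAdd 1)

/-- The generating set `{a, b, c, d, z}` of `𝔊 × ℤ`. [cite: BenjaminiSchramm1996, §2 (Cayley graphs)] -/
def gzGens : Finset GZ := {aP, bP, cP, dP, zP}

/-- **The Cayley graph `Cay(𝔊 × ℤ; a, b, c, d, z)`**: the RIGHT Cayley graph of the group `𝔊 × ℤ` (first Grigorchuk group times the integers) on the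
generating set `{a, b, c, d, z}` = `gzGens` (`u — u·y` for `y ∈ {a, b, c, d, z^{±1}}`; as a graph `= Cay(𝔊; a,b,c,d) □ ℤ`); an `abbrev`, so the tree's instances
for `mulCayley` of a finite set are found through it. [cite: BenjaminiSchramm1996, §2 (Cayley graphs)] -/
abbrev gzCay : SimpleGraph GZ := mulCayley (↑gzGens : Set GZ)

/-- The element of `𝔊 × ℤ` named by a code (`s ↦ z`, `si ↦ z⁻¹`). [folklore] -/
def L6.toP : L6 → GZ
  | .a => aP
  | .b => bP
  | .c => cP
  | .d => dP
  | .s => zP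
  | .si => zP⁻¹

/-- `𝔊`-coordinates of the letters: the tree word's `evalPerm`. [folklore] -/
theorem coe_fst_toP (y : L6) : (((L6.toP y).1 : ↥grigorchukGroup) : Equiv.Perm Ray) = evalPerm y.treeWord := by
  cases y
  · simp only [L6.toP, aP, L6.treeWord, evalPerm_cons, evalPerm_nil, Letter.toPerm, mul_one]; rfl
  · simp only [L6.toP, bP, L6.treeWord, evalPerm_cons, evalPerm_nil, Letter.toPerm, BCD.toPerm, BCD.toV4, V4.toPerm, mul_one]; rfl
  · simp only [L6.toP, cP, L6.treeWord, evalPerm_cons, evalPerm_nil, Letter.toPerm, BCD.toPerm, BCD.toV4, V4.toPerm, mul_one]; rfl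
  · simp only [L6.toP, dP, L6.treeWord, evalPerm_cons, evalPerm_nil, Letter.toPerm, BCD.toPerm, BCD.toV4, V4.toPerm, mul_one]; rfl
  · simp only [L6.toP, zP, L6.treeWord, evalPerm_nil]; rfl
  · simp only [L6.toP, zP, L6.treeWord, evalPerm_nil, Prod.inv_mk, inv_one]; rfl

/-- `ℤ`-coordinates of the letters: the lamp sum of the code. [folklore] -/
theorem snd_toP (y : L6) : (L6.toP y).2 = Multiplicative.ofAdd y.lsum := by
  cases y
  · rfl
  · rfl
  · rfl
  · rfl
  · rfl
  · simp only [L6.toP, zP, L6.lsum, Prod.inv_mk, ofAdd_neg]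

/-- The product of the elements named by a list of codes. [folklore] -/
def prodP : List L6 → GZ
  | [] => 1
  | y :: ys => L6.toP y * prodP ys

/-- `𝔊`-coordinate of a product: the `evalPerm` of the tree words. [folklore] -/
theorem coe_fst_prodP (ys : List L6) : (((prodP ys).1 : ↥grigorchukGroup) : Equiv.Perm Ray) = evalPerm (treeWords ys) := by
  induction ys with
  | nil => rfl
  | cons y ys ih => rw [prodP, treeWords, Prod.fst_mul, Subgroup.coe_mul, coe_fst_toP, ih, evalPerm_append]

/-- `ℤ`-coordinate of a product: the lamp-sum total. [folklore] -/
theorem snd_prodP (ys : List L6) : (prodP ys).2 = Multiplicative.ofAdd (lsums ys) := by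
  induction ys with
  | nil => rfl
  | cons y ys ih => rw [prodP, lsums, Prod.snd_mul, snd_toP, ih, ofAdd_add]

/-! ### §2 Separation (the Boolean test `sepB` of p606146: different lamp sums, or tree words separated by the finite model on `000` / `100`) -/

/-- **Soundness of the separation test in `𝔊 × ℤ`**: `sepB ys ys′ ⟹ prodP ys ≠ prodP ys′`. [folklore] -/
theorem prodP_ne_of_sep {ys ys' : List L6} (h : sepB ys ys' = true) : prodP ys ≠ prodP ys' := by
  intro e
  simp only [sepB, Bool.or_eq_true, decide_eq_true_eq, bne_iff_ne, ne_eq] at h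
  rcases h with h | h | h
  · apply h
    have := congrArg (fun π : GZ => Multiplicative.toAdd π.2) e
    simpa only [snd_prodP, toAdd_ofAdd] using this
  · exact ne_of_evalModel_ne h (by rw [← coe_fst_prodP, ← coe_fst_prodP, e])
  · exact ne_of_evalModel_ne h (by rw [← coe_fst_prodP, ← coe_fst_prodP, e])

/-- **No product of two letters is `a`** (no triangle through an `a`-edge). [folklore] -/
theorem letter_mul_ne_aP (y z : L6) : L6.toP y * L6.toP z ≠ aP := by
  have h : prodP [y, z] ≠ prodP [.a] := prodP_ne_of_sep (by cases y <;> cases z <;> decide)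
  simpa only [prodP, mul_one, L6.toP] using h

/-- **No product of two letters is `z`** (no triangle through a `z`-edge). [folklore] -/
theorem letter_mul_ne_zP (y z : L6) : L6.toP y * L6.toP z ≠ zP := by
  have h : prodP [y, z] ≠ prodP [.s] := prodP_ne_of_sep (by cases y <;> cases z <;> decide)
  simpa only [prodP, mul_one, L6.toP] using h

/-- **`a t y ≠ t′` for tree letters `t, t′` and any letter `y`** (no square through an `a`-edge with two tree-letter corners). [folklore] -/
theorem aP_tree_letter_ne (t y t' : L6) (ht : t.isTree = true) (ht' : t'.isTree = true) : aP * L6.toP t * L6.toP y ≠ L6.toP t' := by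
  have h : prodP [.a, t, y] ≠ prodP [t'] := prodP_ne_of_sep (by
    revert ht ht'
    cases t <;> cases t' <;> intro ht ht' <;> first | exact absurd ht (by decide) | exact absurd ht' (by decide) | (cases y <;> decide))
  simpa only [prodP, mul_one, L6.toP, mul_assoc] using h

/-- **The six letters are `≠ 1`.** [folklore] -/
theorem toP_ne_one (y : L6) : L6.toP y ≠ 1 := by
  have h : prodP [y] ≠ prodP [] := prodP_ne_of_sep (by cases y <;> decide)
  simpa only [prodP, mul_one] using h

/-- The tree letters and `a` are involutions in `𝔊 × ℤ`; `(z⁻¹)⁻¹ = z`. [cite: Grigorchuk1980, a² = b² = c² = d² = 1] -/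
theorem toP_inv (y : L6) : ∃ y' : L6, (L6.toP y)⁻¹ = L6.toP y' := by
  cases y
  · exact ⟨.a, Prod.ext ((toG_inv .a).trans rfl) inv_one⟩
  · exact ⟨.b, Prod.ext ((toG_inv (.x .b)).trans rfl) inv_one⟩
  · exact ⟨.c, Prod.ext ((toG_inv (.x .c)).trans rfl) inv_one⟩
  · exact ⟨.d, Prod.ext ((toG_inv (.x .d)).trans rfl) inv_one⟩
  · exact ⟨.si, rfl⟩
  · exact ⟨.s, inv_inv _⟩

/-- The tree letters square to `1` in `𝔊 × ℤ`. [cite: Grigorchuk1980, a² = b² = c² = d² = 1] -/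
theorem toP_mul_self (y : L6) (hy : y = .a ∨ y.isTree = true) : L6.toP y * L6.toP y = 1 := by
  rcases y with _ | _ | _ | _ | _ | _
  · exact Prod.ext (Letter.toG_mul_self .a) (mul_one _)
  · exact Prod.ext (Letter.toG_mul_self (.x .b)) (mul_one _)
  · exact Prod.ext (Letter.toG_mul_self (.x .c)) (mul_one _)
  · exact Prod.ext (Letter.toG_mul_self (.x .d)) (mul_one _)
  · rcases hy with h | h <;> exact absurd h (by decide)
  · rcases hy with h | h <;> exact absurd h (by decide)

/-- **The Klein table in `𝔊 × ℤ`**: `b c = d`, `c b = d`, `b d = c`, `d b = c`, `c d = b`, `d c = b`. [cite: Grigorchuk1980, bcd = 1] -/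
theorem kleinP : bP * cP = dP ∧ cP * bP = dP ∧ bP * dP = cP ∧ dP * bP = cP ∧ cP * dP = bP ∧ dP * cP = bP :=
  ⟨Prod.ext kleinG.1 (mul_one _), Prod.ext kleinG.2.1 (mul_one _), Prod.ext kleinG.2.2.1 (mul_one _), Prod.ext kleinG.2.2.2.1 (mul_one _),
    Prod.ext kleinG.2.2.2.2.1 (mul_one _), Prod.ext kleinG.2.2.2.2.2 (mul_one _)⟩

/-- **`z` is central**: it commutes with every letter. [folklore] -/
theorem zP_comm (y : L6) : zP * L6.toP y = L6.toP y * zP :=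
  Prod.ext (by rw [Prod.fst_mul, Prod.fst_mul]; change (1 : ↥grigorchukGroup) * _ = _ * 1; rw [one_mul, mul_one])
    (by rw [Prod.snd_mul, Prod.snd_mul, mul_comm])

/-- `x ∈ S ∪ S⁻¹` iff `x` is one of the six letters named by codes. [folklore] -/
theorem mem_gzGens_or_inv_iff {x : GZ} : (x ∈ gzGens ∨ x⁻¹ ∈ gzGens) ↔ ∃ y : L6, x = L6.toP y := by
  have hinv : aP⁻¹ = aP ∧ bP⁻¹ = bP ∧ cP⁻¹ = cP ∧ dP⁻¹ = dP :=
    ⟨inv_eq_of_mul_eq_one_right (toP_mul_self .a (Or.inl rfl)), inv_eq_of_mul_eq_one_right (toP_mul_self .b (Or.inr rfl)),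
      inv_eq_of_mul_eq_one_right (toP_mul_self .c (Or.inr rfl)), inv_eq_of_mul_eq_one_right (toP_mul_self .d (Or.inr rfl))⟩
  have key : (x = aP ∨ x = bP ∨ x = cP ∨ x = dP ∨ x = zP ∨ x = zP⁻¹) ↔ ∃ y : L6, x = L6.toP y := by
    constructor
    · rintro (rfl | rfl | rfl | rfl | rfl | rfl)
      exacts [⟨.a, rfl⟩, ⟨.b, rfl⟩, ⟨.c, rfl⟩, ⟨.d, rfl⟩, ⟨.s, rfl⟩, ⟨.si, rfl⟩]
    · rintro ⟨y, rfl⟩; cases y <;> simp [L6.toP]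
  rw [← key]
  simp only [gzGens, Finset.mem_insert, Finset.mem_singleton, inv_eq_iff_eq_inv, hinv.1, hinv.2.1, hinv.2.2.1, hinv.2.2.2]
  tauto

/-- **Neighbours are right multiples by the six letters.** [cite: BenjaminiSchramm1996, §2 (Cayley graphs)] -/
theorem gzCay_adj_iff {u w : GZ} : gzCay.Adj u w ↔ ∃ y : L6, w = u * L6.toP y := by
  constructor
  · intro h
    obtain ⟨x, -, hx, rfl⟩ := CayleyCosets.exists_letter_of_adj gzGens h
    obtain ⟨y, rfl⟩ := mem_gzGens_or_inv_iff.1 hx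
    exact ⟨y, rfl⟩
  · rintro ⟨y, rfl⟩
    exact CayleyCosets.adj_mul_letter gzGens (mem_gzGens_or_inv_iff.2 ⟨y, rfl⟩) (toP_ne_one y)

/-- `u — u·y` for every code `y`. [folklore] -/
theorem gzCay_adj_mul (u : GZ) (y : L6) : gzCay.Adj u (u * L6.toP y) := gzCay_adj_iff.2 ⟨y, rfl⟩

/-! ### §3 The census: triangles, `T`-cornered squares, the classes -/

/-- **Triangles sit exactly on the tree letters**: `TriE (u, u·y)` iff `y ∈ {b, c, d}`. [folklore] -/
theorem triE_iff_P (u : GZ) (y : L6) : TriE gzCay u (u * L6.toP y) ↔ y.isTree = true := by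
  constructor
  · rintro ⟨w, h1, h2⟩
    obtain ⟨x, rfl⟩ := gzCay_adj_iff.1 h1
    obtain ⟨x', hx'⟩ := gzCay_adj_iff.1 h2
    obtain ⟨x'', hx''⟩ := toP_inv x'
    have e1 : L6.toP x = L6.toP y * L6.toP x' := mul_left_cancel (by rw [← mul_assoc]; exact hx')
    have e : L6.toP y = L6.toP x * L6.toP x'' := by rw [← hx'', e1, mul_inv_cancel_right]
    cases y
    · exact absurd e.symm (letter_mul_ne_aP x x'')
    · rfl
    · rfl
    · rfl
    · exact absurd e.symm (letter_mul_ne_zP x x'')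
    · exfalso
      obtain ⟨x₁, hx₁⟩ := toP_inv x
      obtain ⟨x₂, hx₂⟩ := toP_inv x''
      refine letter_mul_ne_zP x₂ x₁ ?_
      rw [← hx₁, ← hx₂, ← mul_inv_rev, ← e, L6.toP, inv_inv]
  · intro hy
    cases y
    · exact absurd hy (by decide)
    · exact ⟨u * cP, gzCay_adj_mul u .c, by
        have : u * cP = u * bP * dP := by rw [mul_assoc, kleinP.2.2.1]
        rw [this]; exact gzCay_adj_mul _ .d⟩
    · exact ⟨u * bP, gzCay_adj_mul u .b, by
        have : u * bP = u * cP * dP := by rw [mul_assoc, kleinP.2.2.2.2.1]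
        rw [this]; exact gzCay_adj_mul _ .d⟩
    · exact ⟨u * bP, gzCay_adj_mul u .b, by
        have : u * bP = u * dP * cP := by rw [mul_assoc, kleinP.2.2.2.2.2]
        rw [this]; exact gzCay_adj_mul _ .c⟩
    · exact absurd hy (by decide)
    · exact absurd hy (by decide)

/-- **`T`-cornered squares through the `z`-edges**: `SqT (u, u·z)` and `SqT (u, u·z⁻¹)` (`z` commutes with `b`). [folklore] -/
theorem sqT_zP (u : GZ) : SqT gzCay u (u * zP) ∧ SqT gzCay u (u * zP⁻¹) := by
  have hzb : zP * bP = bP * zP := zP_comm .b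
  have hsb : zP⁻¹ * bP = bP * zP⁻¹ := by
    rw [inv_mul_eq_iff_eq_mul, ← mul_assoc, hzb, mul_assoc, mul_inv_cancel, mul_one]
  constructor
  · refine ⟨u * zP * bP, u * bP, gzCay_adj_mul _ .b, (triE_iff_P _ .b).2 rfl, gzCay_adj_mul _ .b, (triE_iff_P _ .b).2 rfl, ?_⟩
    have : u * zP * bP = u * bP * zP := by rw [mul_assoc, hzb, mul_assoc]
    rw [this]; exact (gzCay_adj_mul (u * bP) .s).symm
  · refine ⟨u * zP⁻¹ * bP, u * bP, gzCay_adj_mul _ .b, (triE_iff_P _ .b).2 rfl, gzCay_adj_mul _ .b, (triE_iff_P _ .b).2 rfl, ?_⟩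
    have : u * zP⁻¹ * bP = u * bP * zP⁻¹ := by rw [mul_assoc, hsb, mul_assoc]
    rw [this]; exact (gzCay_adj_mul (u * bP) .si).symm

/-- **No `T`-cornered square through an `a`-edge** (`a t y ≠ t′`). [folklore] -/
theorem not_sqT_aP (u : GZ) : ¬ SqT gzCay u (u * aP) := by
  rintro ⟨w, x, h1, h2, h3, h4, h5⟩
  obtain ⟨t, rfl⟩ := gzCay_adj_iff.1 h1
  obtain ⟨t', rfl⟩ := gzCay_adj_iff.1 h3
  obtain ⟨y, hy⟩ := gzCay_adj_iff.1 h5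
  have ht := (triE_iff_P _ t).1 h2
  have ht' := (triE_iff_P _ t').1 h4
  refine aP_tree_letter_ne t y t' ht ht' ?_
  have := hy; rw [mul_assoc u, mul_assoc u] at this
  exact (mul_left_cancel this).symm

/-- **The classes of the six edges at a vertex**: `IsA` at `a`, `IsT` at `b, c, d`, `IsS` at `z^{±1}`. [folklore] -/
theorem classesP (u : GZ) : IsA gzCay u (u * aP) ∧ (∀ y : L6, y.isTree = true → IsT gzCay u (u * L6.toP y)) ∧
    IsS gzCay u (u * zP) ∧ IsS gzCay u (u * zP⁻¹) := by
  refine ⟨⟨gzCay_adj_mul u .a, fun h => absurd ((triE_iff_P u .a).1 h) (by decide), not_sqT_aP u⟩,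
    fun y hy => ⟨gzCay_adj_mul u y, (triE_iff_P u y).2 hy⟩,
    ⟨gzCay_adj_mul u .s, fun h => absurd ((triE_iff_P u .s).1 h) (by decide), (sqT_zP u).1⟩,
    ⟨gzCay_adj_mul u .si, fun h => absurd ((triE_iff_P u .si).1 h) (by decide), (sqT_zP u).2⟩⟩

/-- **An `A`-neighbour is `u·a`.** [folklore] -/
theorem eq_of_isA_P {u w : GZ} (h : IsA gzCay u w) : w = u * aP := by
  obtain ⟨hadj, hntri, hnsq⟩ := h
  obtain ⟨y, rfl⟩ := gzCay_adj_iff.1 hadj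
  cases y
  · rfl
  · exact absurd ((triE_iff_P u .b).2 rfl) hntri
  · exact absurd ((triE_iff_P u .c).2 rfl) hntri
  · exact absurd ((triE_iff_P u .d).2 rfl) hntri
  · exact absurd (sqT_zP u).1 hnsq
  · exact absurd (sqT_zP u).2 hnsq

/-- **A `T`-neighbour is `u·t` for a tree letter.** [folklore] -/
theorem exists_of_isT_P {u w : GZ} (h : IsT gzCay u w) : ∃ y : L6, y.isTree = true ∧ w = u * L6.toP y := by
  obtain ⟨hadj, htri⟩ := h
  obtain ⟨y, rfl⟩ := gzCay_adj_iff.1 hadj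
  exact ⟨y, (triE_iff_P u y).1 htri, rfl⟩

/-- **An `S`-neighbour is `u·z^{±1}`.** [folklore] -/
theorem eq_of_isS_P {u w : GZ} (h : IsS gzCay u w) : w = u * zP ∨ w = u * zP⁻¹ := by
  obtain ⟨hadj, hntri, hsq⟩ := h
  obtain ⟨y, rfl⟩ := gzCay_adj_iff.1 hadj
  cases y
  · exact absurd hsq (not_sqT_aP u)
  · exact absurd ((triE_iff_P u .b).2 rfl) hntri
  · exact absurd ((triE_iff_P u .c).2 rfl) hntri
  · exact absurd ((triE_iff_P u .d).2 rfl) hntri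
  · exact Or.inl rfl
  · exact Or.inr rfl

end Grigorchuk

end Summit.CriticalPhenomena.PercolationContinuityZ3.Theorems.Transplant
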